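import Literature.NumberTheory.QuadraticFields.SquareRootsModuloCount
import Literature.NumberTheory.QuadraticFields.ReducedFormsLeadingCoefficients
import HarnessLib

/-!
# `ν(a) ≤ 2^{ω(a)}`: at most `2^{ω(n)}` reduced forms of a fundamental discriminant have leading coefficient
# `n`, and the census `Σ_{Q reduced} 1/a_Q ≤ h(D)/(N+1) + Σ_{n ≤ N} 2^{ω(n)}/n`

Topic `Literature/NumberTheory/QuadraticFields` (namespaces `Literature.NumberTheory.QuadraticFields.SqrtModCount`
and `….BinaryQuadraticForm.LeadingCoeff`, continuing `SquareRootsModuloCount.lean` and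
`ReducedFormsLeadingCoefficients.lean`). Everything in this file is PROVED (theorems only; no definition, no
named fact). Written for the cell `parity-realchar` (SIEGEL INSTRUMENT): it is the SHARP form of the census
feeding the class-summed Goldfeld–Schinzel inequality — the tree's `RealZeroRepulsionOddLogClassNumber.lean`
used `#{Q : a_Q = n} ≤ 2τ(n)` (`SqrtModCount.card_Ioc_roots_le_two_mul_card_divisors`); the consumer of the
present file, `Literature/NumberTheory/LFunctions/RealZeroRepulsionOddLogClassNumberSharp.lean`, needs
Ralaivaosaona–Razakarinoro's `ν(a) ≤ 2^{w(a)}` (J. Number Theory 281 (2026), proof of Lemma 2, p. 803: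
"using Lemma 1, we can show that `ν(a) ≤ 2^{w(a)}`, where `w(n)` denotes the number of distinct prime divisors
of `n`"; Lemma 1, p. 802: "`ν(p^α) = 1 + χ(p)` if `p ∤ d` or `α = 1`, `0` otherwise"), because the leading
constant of `Σ_{n ≤ y} 2^{w(n)}/n = (3/π²)(log y)² + O(log y)` (their Lemma 5) is what produces the `2π` of
their Theorem 2. Here `ν(a)` is, as in `ReducedFormsLeadingCoefficients.lean`, the count
`#{b ∈ (−a, a] : 4a ∣ b² − D}` (R–R p. 801: the primitive ideals of norm `a` are the
`[a, (b + √−d)/2]` with `−a < b ≤ a`, `b² ≡ −d (mod 4a)`).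

Write `N_D(m) = #{x ∈ [0, m) : m ∣ x² − D}` (no definition introduced). For a fundamental discriminant `D`
(`D ≡ 1 (mod 4)` squarefree, or `D = 4m'`, `m' ≡ 2, 3 (mod 4)` squarefree — the tree's spelling):

* `card_roots_le_two_pow_of_odd` — `N_D(m) ≤ 2^{ω(m)}` for odd `m` (CRT and `N_D(p^k) ≤ 2`, tree lemmas);
* `card_roots_four_mul_le` — `N_D(4n) ≤ 2·2^{ω(n)}` (`n ≥ 1`; the `2`-part of `4n` contributes `N_D(4) ≤ 2`
  for odd `n`, else `≤ 4` with one more prime factor);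
* `two_mul_card_Ioc_roots_le` — `2·#{b ∈ (−n, n] : 4n ∣ b² − D} ≤ N_D(4n)` for every `D` (`b ↦ b mod 4n` and
  `b ↦ b + 2n mod 4n` are injective with disjoint images in the roots mod `4n`);
* `card_Ioc_roots_le_two_pow` — **`#{b ∈ (−n, n] : 4n ∣ b² − D} ≤ 2^{ω(n)}`**, i.e. `ν(n) ≤ 2^{ω(n)}`;
* `LeadingCoeff.card_fiber_le_two_pow` — **`#{Q ∈ reducedForms D : a_Q = n} ≤ 2^{ω(n)}`** (`D < 0` fundamental);
* `LeadingCoeff.sum_inv_fst_le_sum_two_pow_omega_div` — **`Σ_{Q reduced} 1/a_Q ≤ h(D)/(N+1) + Σ_{n ≤ N} 2^{ω(n)}/n`**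
  for every `N ≥ 1` (the rearrangement lemma `sum_one_div_le_of_card_fiber_le` of the tree — R–R's (41)).

`ω(n)` is spelled `n.primeFactors.card`.

## References

* [RalaivaosaonaRazakarinoro2026] D. Ralaivaosaona, F. B. Razakarinoro, J. Number Theory 281 (2026) 795–829:
  Lemma 1 (p. 802), proof of Lemma 2 (p. 803), (41) (p. 817).
* [Apostol1976] Thm 5.28 (root counts for coprime moduli multiply); §5.9.
* [Cox2013] §2.A (2.7), Thm. 2.8 (reduced forms).
-/

open Finset

namespace Literature.NumberTheory.QuadraticFields

namespace SqrtModCount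

/-! ### `N_D(m) ≤ 2^{ω(m)}` for odd `m`, and `N_D(4n) ≤ 2·2^{ω(n)}` -/

/-- For a fundamental discriminant and an odd prime `p`: `p² ∤ D`. [folklore] -/
private theorem not_sq_dvd_of_fundamental' {D : ℤ}
    (hD : (D % 4 = 1 ∧ Squarefree D) ∨ (4 ∣ D ∧ (D / 4 % 4 = 2 ∨ D / 4 % 4 = 3) ∧ Squarefree (D / 4)))
    {p : ℕ} (hp : p.Prime) (hp2 : p ≠ 2) : ¬ ((p : ℤ) ^ 2 ∣ D) := by
  intro hsq
  have hpu : ¬ IsUnit (p : ℤ) := by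
    rw [Int.isUnit_iff]; have := hp.two_le; omega
  rcases hD with ⟨-, hsf⟩ | ⟨h4, -, hsf⟩
  · exact hpu (hsf p (by rw [← sq]; exact hsq))
  · have hD4 : D = 4 * (D / 4) := by rw [Int.mul_ediv_cancel' h4]
    have hcopN : Nat.Coprime (p ^ 2) 4 := by
      have : Nat.Coprime p 2 := (Nat.coprime_primes hp Nat.prime_two).mpr hp2
      simpa using (this.pow 2 2)
    have hcop : IsCoprime ((p : ℤ) ^ 2) (4 : ℤ) := by
      have := Nat.isCoprime_iff_coprime.mpr hcopN
      push_cast at this; exact this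
    have hsq' : (p : ℤ) ^ 2 ∣ 4 * (D / 4) := by rw [← hD4]; exact hsq
    have hdiv : (p : ℤ) ^ 2 ∣ D / 4 := hcop.dvd_of_dvd_mul_left hsq'
    exact hpu (hsf p (by rw [← sq]; exact hdiv))

/-- **`N_D(m) ≤ 2^{ω(m)}` for odd `m`** and a fundamental discriminant `D`: by the Chinese remainder theorem
over the prime-power factorisation, with `N_D(p^k) ≤ 2` for odd `p`, `p² ∤ D`
(`card_roots_prime_pow_le_two`). [cite: RalaivaosaonaRazakarinoro2026, Lemma 1] [cite: Apostol1976, Theorem 5.28] -/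
theorem card_roots_le_two_pow_of_odd {D : ℤ}
    (hD : (D % 4 = 1 ∧ Squarefree D) ∨ (4 ∣ D ∧ (D / 4 % 4 = 2 ∨ D / 4 % 4 = 3) ∧ Squarefree (D / 4)))
    {m : ℕ} (hm : Odd m) :
    ((Finset.range m).filter (fun x : ℕ => (m : ℤ) ∣ (x : ℤ) ^ 2 - D)).card ≤ 2 ^ m.primeFactors.card := by
  classical
  induction m using Nat.recOnPosPrimePosCoprime with
  | prime_pow p k hp hk =>
    have hp2 : p ≠ 2 := by
      rintro rfl
      have h2 : Odd 2 := (Nat.odd_pow_iff hk.ne').mp hm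
      exact absurd h2 (by decide)
    rw [Nat.primeFactors_prime_pow hk.ne' hp, Finset.card_singleton, pow_one]
    exact card_roots_prime_pow_le_two hp hp2 hk (not_sq_dvd_of_fundamental' hD hp hp2)
  | zero => exact absurd hm (by decide)
  | one =>
    calc _ ≤ (Finset.range 1).card := Finset.card_filter_le _ _
      _ = 2 ^ (Nat.primeFactors 1).card := by simp
  | coprime a b ha hb hcop iha ihb =>
    obtain ⟨hao, hbo⟩ := Nat.odd_mul.mp hm
    rw [Nat.Coprime.primeFactors_mul hcop, Finset.card_union_of_disjoint (Nat.Coprime.disjoint_primeFactors hcop),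
      pow_add]
    exact (card_roots_mul_le a b hcop D).trans (Nat.mul_le_mul (iha hao) (ihb hbo))

/-- **`N_D(4n) ≤ 2·2^{ω(n)}`** (`n ≥ 1`, `D` fundamental): write `n = 2^j n'` with `n'` odd; then
`N_D(4n) ≤ N_D(2^{j+2})·N_D(n') ≤ N_D(2^{j+2})·2^{ω(n')}` with `N_D(4) ≤ 2` (`j = 0`) and `N_D(2^{j+2}) ≤ 4`
(`j ≥ 1`: odd `D`, or `N_D(8) ≤ 4`, or no roots mod `2^{j+2} ≥ 16` when `4 ∣ D`), while `ω(n) = ω(n') + 1`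
for `j ≥ 1`. [cite: RalaivaosaonaRazakarinoro2026, Lemma 1] [cite: Apostol1976, Theorem 5.28] -/
theorem card_roots_four_mul_le {D : ℤ}
    (hD : (D % 4 = 1 ∧ Squarefree D) ∨ (4 ∣ D ∧ (D / 4 % 4 = 2 ∨ D / 4 % 4 = 3) ∧ Squarefree (D / 4)))
    {n : ℕ} (hn : 0 < n) :
    ((Finset.range (4 * n)).filter (fun x : ℕ => ((4 * n : ℕ) : ℤ) ∣ (x : ℤ) ^ 2 - D)).card ≤
      2 * 2 ^ n.primeFactors.card := by
  classical
  obtain ⟨j, n', hodd, rfl⟩ := Nat.exists_eq_two_pow_mul_odd hn.ne'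
  have hn'0 : n' ≠ 0 := by rintro rfl; exact absurd hodd (by decide)
  have hcop : Nat.Coprime (2 ^ (j + 2)) n' := Nat.Coprime.pow_left _ (Odd.coprime_two_left hodd)
  have e4 : 4 * (2 ^ j * n') = 2 ^ (j + 2) * n' := by ring
  rw [e4]
  have hmul := card_roots_mul_le (2 ^ (j + 2)) n' hcop D
  have hodd' := card_roots_le_two_pow_of_odd hD hodd
  refine hmul.trans ?_
  rcases Nat.eq_zero_or_pos j with rfl | hj
  · -- `j = 0`: the `2`-part is `N_D(4) ≤ 2`, and `ω(n) = ω(n')`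
    have h4 : ((Finset.range (2 ^ (0 + 2))).filter
        (fun x : ℕ => ((2 ^ (0 + 2) : ℕ) : ℤ) ∣ (x : ℤ) ^ 2 - D)).card ≤ 2 := by
      have := card_roots_four_le D
      simpa using this
    rw [pow_zero, one_mul]
    exact Nat.mul_le_mul h4 hodd'
  · -- `j ≥ 1`: the `2`-part is at most `4`, and `ω(n) = ω(n') + 1`
    have h2part : ((Finset.range (2 ^ (j + 2))).filter
        (fun x : ℕ => ((2 ^ (j + 2) : ℕ) : ℤ) ∣ (x : ℤ) ^ 2 - D)).card ≤ 4 := by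
      rcases hD with ⟨h1, -⟩ | ⟨h4, hm, -⟩
      · have hoddD : Odd D := Int.odd_iff.mpr (by omega)
        exact card_roots_two_pow_le_four_of_odd (by omega) hoddD
      · rcases Nat.lt_or_ge j 2 with hj2 | hj2
        · have hj1 : j = 1 := by omega
          subst hj1
          have := card_roots_eight_le D
          simpa using this
        · rw [card_roots_two_pow_eq_zero (by omega) h4 hm]; omega
    have hω : (2 ^ j * n').primeFactors.card = n'.primeFactors.card + 1 := by
      have hcop' : Nat.Coprime (2 ^ j) n' := Nat.Coprime.pow_left _ (Odd.coprime_two_left hodd)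
      rw [Nat.Coprime.primeFactors_mul hcop', Finset.card_union_of_disjoint (Nat.Coprime.disjoint_primeFactors hcop'),
        Nat.primeFactors_prime_pow hj.ne' Nat.prime_two, Finset.card_singleton, add_comm]
    rw [hω, pow_succ]
    calc _ ≤ 4 * 2 ^ n'.primeFactors.card := Nat.mul_le_mul h2part hodd'
      _ = 2 * (2 ^ n'.primeFactors.card * 2) := by ring

/-! ### From roots mod `4n` to `b ∈ (−n, n]`, without loss -/

/-- `m ∣ x² − D ↔ m ∣ y² − D` when `x ≡ y (mod m)`. [folklore] -/
private theorem dvd_sq_sub_iff' {m x y : ℤ} (h : x ≡ y [ZMOD m]) (D : ℤ) :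
    m ∣ x ^ 2 - D ↔ m ∣ y ^ 2 - D := by
  have h2 : x ^ 2 ≡ y ^ 2 [ZMOD m] := h.pow 2
  constructor
  · intro hx
    have : y ^ 2 - D = (x ^ 2 - D) + (y ^ 2 - x ^ 2) := by ring
    rw [this]
    exact dvd_add hx (Int.ModEq.dvd h2)
  · intro hy
    have : x ^ 2 - D = (y ^ 2 - D) + (x ^ 2 - y ^ 2) := by ring
    rw [this]
    exact dvd_add hy (Int.ModEq.dvd h2.symm)

/-- **`2·#{b ∈ (−n, n] : 4n ∣ b² − D} ≤ N_D(4n)`** (`n ≥ 1`, any `D`): the maps `b ↦ b mod 4n` and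
`b ↦ (b + 2n) mod 4n` send such `b` injectively to roots of `D` modulo `4n` in `[0, 4n)` (note
`(b + 2n)² − b² = 4n(b + n)`), with disjoint images (`0 < b′ + 2n − b < 4n`). This is the statement that
`ν(a)`, the number of `b (mod 2a)` with `b² ≡ −d (mod 4a)`, is half the number of square roots of `−d`
modulo `4a`. [cite: RalaivaosaonaRazakarinoro2026, §2.2 p. 801 and Lemma 1] -/
theorem two_mul_card_Ioc_roots_le {n : ℕ} (hn : 0 < n) (D : ℤ) :
    2 * ((Finset.Ioc (-(n : ℤ)) n).filter (fun b => (4 * n : ℤ) ∣ b ^ 2 - D)).card ≤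
      ((Finset.range (4 * n)).filter (fun x : ℕ => ((4 * n : ℕ) : ℤ) ∣ (x : ℤ) ^ 2 - D)).card := by
  classical
  set S := (Finset.Ioc (-(n : ℤ)) n).filter (fun b => (4 * n : ℤ) ∣ b ^ 2 - D) with hS
  set R := (Finset.range (4 * n)).filter (fun x : ℕ => ((4 * n : ℕ) : ℤ) ∣ (x : ℤ) ^ 2 - D) with hR
  set M : ℤ := 4 * n with hM
  have hM0 : 0 < M := by rw [hM]; exact_mod_cast (by omega : 0 < 4 * n)
  have hMcast : ((4 * n : ℕ) : ℤ) = M := by rw [hM]; push_cast; ring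
  -- the two maps
  set g₁ : ℤ → ℕ := fun b => (b % M).toNat with hg₁
  set g₂ : ℤ → ℕ := fun b => ((b + 2 * n) % M).toNat with hg₂
  have hg₁cast : ∀ b : ℤ, ((g₁ b : ℕ) : ℤ) = b % M := fun b =>
    Int.toNat_of_nonneg (Int.emod_nonneg _ hM0.ne')
  have hg₂cast : ∀ b : ℤ, ((g₂ b : ℕ) : ℤ) = (b + 2 * n) % M := fun b =>
    Int.toNat_of_nonneg (Int.emod_nonneg _ hM0.ne')
  -- membership facts for `b ∈ S`
  have hmemS : ∀ b ∈ S, -(n : ℤ) < b ∧ b ≤ n ∧ M ∣ b ^ 2 - D := by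
    intro b hb
    rw [hS, Finset.mem_filter, Finset.mem_Ioc] at hb
    exact ⟨hb.1.1, hb.1.2, by rw [hM]; exact hb.2⟩
  have hmemR : ∀ x : ℕ, (x : ℤ) < M → M ∣ (x : ℤ) ^ 2 - D → x ∈ R := by
    intro x hx hdvd
    rw [hR, Finset.mem_filter, Finset.mem_range, hMcast]
    refine ⟨?_, hdvd⟩
    have : (x : ℤ) < ((4 * n : ℕ) : ℤ) := by rw [hMcast]; exact hx
    exact_mod_cast this
  -- images land in `R`
  have himg₁ : S.image g₁ ⊆ R := by
    intro x hx
    obtain ⟨b, hb, rfl⟩ := Finset.mem_image.mp hx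
    obtain ⟨-, -, hdvd⟩ := hmemS b hb
    refine hmemR _ (by rw [hg₁cast]; exact Int.emod_lt_of_pos _ hM0) ?_
    rw [hg₁cast]
    exact (dvd_sq_sub_iff' (Int.mod_modEq b M) D).mpr hdvd
  have himg₂ : S.image g₂ ⊆ R := by
    intro x hx
    obtain ⟨b, hb, rfl⟩ := Finset.mem_image.mp hx
    obtain ⟨-, -, hdvd⟩ := hmemS b hb
    refine hmemR _ (by rw [hg₂cast]; exact Int.emod_lt_of_pos _ hM0) ?_
    rw [hg₂cast]
    refine (dvd_sq_sub_iff' (Int.mod_modEq (b + 2 * n) M) D).mpr ?_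
    have : (b + 2 * n) ^ 2 - D = (b ^ 2 - D) + M * (b + n) := by rw [hM]; ring
    rw [this]
    exact dvd_add hdvd (dvd_mul_right _ _)
  -- a difference of two elements of `(−n, n]`, possibly shifted by `2n`, is a multiple of `M` only trivially
  have hsmall : ∀ c : ℤ, M ∣ c → -M < c → c < M → c = 0 := fun c hc h1 h2 =>
    Int.eq_zero_of_abs_lt_dvd hc (abs_lt.mpr ⟨h1, h2⟩)
  have hinj₁ : Set.InjOn g₁ S := by
    intro b hb b' hb' h
    obtain ⟨hb1, hb2, -⟩ := hmemS b (Finset.mem_coe.mp hb)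
    obtain ⟨hb1', hb2', -⟩ := hmemS b' (Finset.mem_coe.mp hb')
    have h' : b % M = b' % M := by
      have := congrArg (fun x : ℕ => (x : ℤ)) h
      simpa only [hg₁cast] using this
    have hdvd : M ∣ b' - b := Int.ModEq.dvd h'
    have := hsmall (b' - b) hdvd (by rw [hM]; omega) (by rw [hM]; omega)
    omega
  have hinj₂ : Set.InjOn g₂ S := by
    intro b hb b' hb' h
    obtain ⟨hb1, hb2, -⟩ := hmemS b (Finset.mem_coe.mp hb)
    obtain ⟨hb1', hb2', -⟩ := hmemS b' (Finset.mem_coe.mp hb')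
    have h' : (b + 2 * n) % M = (b' + 2 * n) % M := by
      have := congrArg (fun x : ℕ => (x : ℤ)) h
      simpa only [hg₂cast] using this
    have hdvd : M ∣ (b' + 2 * n) - (b + 2 * n) := Int.ModEq.dvd h'
    have := hsmall _ hdvd (by rw [hM]; omega) (by rw [hM]; omega)
    omega
  have hdisj : Disjoint (S.image g₁) (S.image g₂) := by
    rw [Finset.disjoint_left]
    intro x hx₁ hx₂
    obtain ⟨b, hb, hbx⟩ := Finset.mem_image.mp hx₁
    obtain ⟨b', hb', hb'x⟩ := Finset.mem_image.mp hx₂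
    obtain ⟨hb1, hb2, -⟩ := hmemS b hb
    obtain ⟨hb1', hb2', -⟩ := hmemS b' hb'
    have h' : b % M = (b' + 2 * n) % M := by
      have e1 := hg₁cast b
      have e2 := hg₂cast b'
      rw [hbx] at e1
      rw [hb'x] at e2
      rw [← e1, ← e2]
    have hdvd : M ∣ (b' + 2 * n) - b := Int.ModEq.dvd h'
    have := hsmall _ hdvd (by rw [hM]; omega) (by rw [hM]; omega)
    omega
  -- count
  calc 2 * S.card = (S.image g₁).card + (S.image g₂).card := by
        rw [Finset.card_image_of_injOn hinj₁, Finset.card_image_of_injOn hinj₂]; ring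
    _ = (S.image g₁ ∪ S.image g₂).card := (Finset.card_union_of_disjoint hdisj).symm
    _ ≤ R.card := Finset.card_le_card (Finset.union_subset himg₁ himg₂)

/-- **`ν(n) ≤ 2^{ω(n)}`: `#{b ∈ (−n, n] : 4n ∣ b² − D} ≤ 2^{ω(n)}`** for a fundamental discriminant `D` and
`n ≥ 1`. [cite: RalaivaosaonaRazakarinoro2026, Lemma 1 and proof of Lemma 2 (p. 803)] -/
theorem card_Ioc_roots_le_two_pow {D : ℤ}
    (hD : (D % 4 = 1 ∧ Squarefree D) ∨ (4 ∣ D ∧ (D / 4 % 4 = 2 ∨ D / 4 % 4 = 3) ∧ Squarefree (D / 4)))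
    {n : ℕ} (hn : 0 < n) :
    ((Finset.Ioc (-(n : ℤ)) n).filter (fun b => (4 * n : ℤ) ∣ b ^ 2 - D)).card ≤ 2 ^ n.primeFactors.card := by
  have h := (two_mul_card_Ioc_roots_le hn D).trans (card_roots_four_mul_le hD hn)
  omega

end SqrtModCount

namespace BinaryQuadraticForm

namespace LeadingCoeff

open SqrtModCount

/-- **At most `2^{ω(n)}` reduced forms of a fundamental discriminant `D < 0` have leading coefficient
`n = k + 1`.** [cite: RalaivaosaonaRazakarinoro2026, Lemma 1 and proof of Lemma 2 (p. 803)]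
[cite: Cox2013, §2.A eq. (2.7)] -/
theorem card_fiber_le_two_pow {D : ℤ} (hD0 : D < 0)
    (hD : (D % 4 = 1 ∧ Squarefree D) ∨ (4 ∣ D ∧ (D / 4 % 4 = 2 ∨ D / 4 % 4 = 3) ∧ Squarefree (D / 4)))
    (k : ℕ) :
    ((reducedForms D).filter (fun Q => Q.1 = (k : ℤ) + 1)).card ≤ 2 ^ (k + 1).primeFactors.card := by
  have h1 := card_filter_fst_eq_le hD0 ((k : ℤ) + 1)
  have h2 := SqrtModCount.card_Ioc_roots_le_two_pow hD (n := k + 1) (Nat.succ_pos k)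
  have e : (((k + 1 : ℕ) : ℤ)) = (k : ℤ) + 1 := by push_cast; ring
  rw [e] at h2
  exact h1.trans h2

/-- **The sharp census: `Σ_{Q ∈ reducedForms D} 1/a_Q ≤ h(D)/(N+1) + Σ_{n=1}^{N} 2^{ω(n)}/n`** for every
fundamental `D < 0` and `N ≥ 1` ("the sum is larger if more ideals have smaller norms", with
`ν(a) ≤ 2^{ω(a)}`). [cite: RalaivaosaonaRazakarinoro2026, (41) p. 817 and Lemma 2] -/
theorem sum_inv_fst_le_sum_two_pow_omega_div {D : ℤ} (hD0 : D < 0)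
    (hD : (D % 4 = 1 ∧ Squarefree D) ∨ (4 ∣ D ∧ (D / 4 % 4 = 2 ∨ D / 4 % 4 = 3) ∧ Squarefree (D / 4)))
    (N : ℕ) :
    ∑ Q ∈ reducedForms D, (1 : ℝ) / (Q.1 : ℝ) ≤
      (BinaryQuadraticForm.classNumber D : ℝ) / ((N : ℝ) + 1) +
        ∑ n ∈ Finset.Icc 1 N, (2 : ℝ) ^ n.primeFactors.card / n := by
  have ha : ∀ Q ∈ reducedForms D, (1 : ℤ) ≤ Q.1 := fun Q hQ => by
    obtain ⟨-, ha, -, -⟩ := (mem_reducedForms_iff hD0).1 hQ; omega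
  have h := sum_one_div_le_of_card_fiber_le (reducedForms D) (fun Q => Q.1)
    ha N (fun k => 2 ^ (k + 1).primeFactors.card) (fun k _ => card_fiber_le_two_pow hD0 hD k)
  have hc : ((reducedForms D).card : ℝ) = (BinaryQuadraticForm.classNumber D : ℝ) := rfl
  rw [hc] at h
  refine h.trans (add_le_add le_rfl ?_)
  -- drop the `−1/(N+1)` and re-index `k + 1 = n`
  have hstep : ∑ k ∈ Finset.range N, ((2 ^ (k + 1).primeFactors.card : ℕ) : ℝ) *
      (1 / ((k : ℝ) + 1) - 1 / ((N : ℝ) + 1)) ≤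
      ∑ k ∈ Finset.range N, ((2 ^ (k + 1).primeFactors.card : ℕ) : ℝ) * (((k + 1 : ℕ) : ℝ))⁻¹ := by
    refine Finset.sum_le_sum fun k _ => ?_
    have hpos : (0 : ℝ) ≤ ((2 ^ (k + 1).primeFactors.card : ℕ) : ℝ) := by positivity
    have hN1 : (0 : ℝ) < 1 / ((N : ℝ) + 1) := by positivity
    have e : (((k + 1 : ℕ) : ℝ))⁻¹ = 1 / ((k : ℝ) + 1) := by push_cast; rw [one_div]
    rw [e]
    nlinarith
  have hshift : ∑ k ∈ Finset.range N, ((2 ^ (k + 1).primeFactors.card : ℕ) : ℝ) * (((k + 1 : ℕ) : ℝ))⁻¹ =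
      ∑ n ∈ Finset.Icc 1 N, ((2 ^ n.primeFactors.card : ℕ) : ℝ) * ((n : ℕ) : ℝ)⁻¹ := by
    rw [Finset.range_eq_Ico, Finset.sum_Ico_add'
      (fun n : ℕ => ((2 ^ n.primeFactors.card : ℕ) : ℝ) * ((n : ℕ) : ℝ)⁻¹) 0 N 1,
      zero_add, Finset.Ico_add_one_right_eq_Icc]
  rw [hshift] at hstep
  refine hstep.trans (le_of_eq (Finset.sum_congr rfl fun n _ => ?_))
  push_cast
  rw [div_eq_mul_inv]

end LeadingCoeff

end BinaryQuadraticForm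

end Literature.NumberTheory.QuadraticFields
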